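import Mathlib
import Summits.AtomisticToContinuum.HydrodynamicLimit.Theorems.InformationPercolationEngineKickFairRelEquilibriumMesoKineticWindowCutDefs
import Literature.MathematicalPhysics.KineticTheory.CollisionWindowCompensator
import Literature.MathematicalPhysics.KineticTheory.BackwardCluster
import Literature.MathematicalPhysics.KineticTheory.EvenStatTruncationBound
import HarnessLib

/-!
# `KickFairRelEquilibriumMeso`, ALT line `kinetic-window-cut` — SW (`SameWindowPairCov`) at CONSTANT profiles:
# the dependency shapes and the count/decorrelation split (worker W4-3, wave 4; assessment scratch, NOT a registered name)

The registered fallback `sameWindowPairCov_const` (SW's body at constant profiles `(a, u, θ)`; copied verbatim as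
`SameWindowPairCovConst`) is NOT provable from landed material.  This file types the inputs it needs, so that the lead
can register / share them, and proves the one elementary reduction among them:

* (I) `SameWindowPairCountConst` — the `N^{1/3}`-normalised count of VALID SAME-WINDOW ordered kick pairs has BOUNDED
  mean under the invariant law.  This is a SECOND (factorial) moment of the window kick counts `K_w = Σ_i D_{i,w}`:
  `(N+1)^{1/3} (ε/(N+1))² Σ_w K_w²`, mean `≍ σ²τλ²` (`λ =` kicks per sphere per window) — `O(1)`, NOT small.  It is the
  same wall as CP's (worker W4-2): the tree's collision engines (`localGibbsLaw_lintegral_le_of_le_collisionMarkSum`,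
  `HardSphereFlow.lintegral_ncard_collisionTimes_Ioc_le`, `…ShortFlightRung0A/B`) bound ONE collision indicator × a static
  mark.  By Cauchy–Schwarz over spheres, `K_w² ≤ (N+1) Σ_i D_{i,w}²`, so (I) follows from the tagged-sphere one-window
  second moment (I′) `WindowCountSqMomentConst` = the hypothesis `(PM|const)` of
  `Theorems.CollisionRate.stub_windowCountSquareTightConst_of_sqMoment` (file
  `…CollisionRateWindowCountSquareTightConst.lean`, documented there as NOT proved: "two-time correlation, Lanford-type
  at fixed reduced density"), up to aligning its windows (`windowLen N τ 2 ≥ tN N` eventually) with `⌊t/tN⌋`.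
  WHY (I) CANNOT BE DODGED: SW charges `|Γ| ≤ 16C²` on a random set of pairs of random size `Σ_w K_w²`; any use of
  "`|Γ| ≤ η` on most far pairs" leaves `η · E[(N+1)^{1/3}ε²/(N+1)² Σ_w K_w²]`, and no first-moment or deterministic bound
  controls `E Σ_w K_w²` (index truncation `n < A(N+1)^{1/3}` bounds `Σ_w K_w`, not `max_w K_w`).
* (II) `TaggedLogWindowSpanTailConst` — the QUANTITATIVE one-window light cone: verbatim the hypothesis `C⁺_log` of
  `gibbsLightCone_of_taggedLogWindowSpanTail` (…RelayRaceLocalityGibbsLightConeBridge.lean), the open content of crux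
  `RelayRaceLocality.GibbsLightCone` (stmt-AtomisticToContinuum-12501; live stubs `stub_slabContactNecklaceBound_two_le`,
  `stub_tiltedSlabContactNecklaceBound`, `gibbsLightCone_of_seams`).  The crux decl ITSELF (fixed `t`, fixed `δ > 0`,
  `Tendsto … (nhds 0)`) is too weak for SW: SW needs influence span `≤ rs N = (N+1)^{-1/4} → 0` inside a window
  `t_N = (N+1)^{-1/3}` (`= σ²√θ·O(1)` mean free times), i.e. a prescribed RATE, which only the exponential-in-`M` log-window
  tail gives (`M = K log(N+2)`: threshold `λ K log(N+2) ℓ_N ≪ rs N`, probability `C (N+2)^{-cK}`, union over `N+1` spheres).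
  (II) is stated at zero drift; drift `u` needs the Galilean covariance of `localGibbsLaw`.)
* (III) `FarPairDecorrelationConst` — far-pair conditional decorrelation in pair-Campbell measure: for every `η > 0`,
  eventually `E_G[(N+1)^{1/3}(ε/(N+1))² ΣΣ 1_{PairFar} (|Γ| − η)₊] ≤ η`.  Its intended proof = (II) + a REGIONAL DECOUPLING
  of the canonical hard-sphere Gibbs law given `≤ 4` coarse global photos (spatial Markov property of the hard-core
  position factor + hard-core chains of length `rs/ε` + the card's "leak" bound for photos at 4 random dynamical times).
  NOTHING of this is in the tree (`lean search` regional / factoris / decoupl / Disagreement / hardCoreChain: no kinetic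
  hits; `posGibbs_pairEvent_le` is a one-pair Ruelle bound; `FirstChaosBessel` p133303 is the abstract Bessel inequality
  for independent σ-algebras only).

PROVED here: `sameWindowPairCovConst_of_count_of_decorrelation : (I) → (III) → SW_const` (pointwise
`1_far |Γ| ≤ η 1_sameWindow + 1_far (|Γ| − η)₊`, `lintegral` additivity via a.e.-measurability of the count integrand on
the good set).  So SW_const = COUNT (I)/(I′) ∧ DECORRELATION (III).  (I′) is the natural count sub-goal to SHARE with
CP_const: CP's off-diagonal close-pair count is `≤` a localised version of (I), and AM–GM + hard-core packing of a
`27 rs³`-neighbourhood (`≤ c N^{1/4}/σ³` centres at ONE time) would make (I′) sufficient for it too, but only after a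
photo-localisation step (the close-cell test reads each sphere at ITS OWN flight start, not at a common time).

Typing of SW (task 3): no mis-statement found — `PairFar` reads the first-photo cells `(p.1.1.1 i).1` (sphere `i` at
its own flight start; `coarsePastOf`'s first component), `¬CellClose ⇒` torus sup-distance `≥ rs N` between the two cells
(seam clause checked), the diagonal is never far (`CellClose k k`), junk pasts live on the `LG`-null bad set, the
normalisation `(N+1)^{1/3}(ε/(N+1))²` is the one WR (p158078) consumes, and the argument orders of `pairCondCovLG σ a θ u` /
`localGibbsLaw σ a u θ` in `sameWindowPairCov_const` match SW.  Caveat (not a mis-typing): SW sums ALL `n < cnt` (WR needs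
only `n < A(N+1)^{1/3}`), but truncation would not remove the second-moment wall (I).
-/

noncomputable section

open MeasureTheory Set Filter Topology
open scoped ENNReal Classical

namespace Summit.AtomisticToContinuum.HydrodynamicLimit.Theorems.KickFairRelEquilibriumMesoLine

open Literature.Analysis.FluidPDE Literature.MathematicalPhysics.KineticTheory

/-! ## The target and its inputs (predicates; nothing asserted) -/

/-- **SW at constant profiles** — verbatim the registered sub-goal `sameWindowPairCov_const` of
stmt-AtomisticToContinuum-15177 (SW's body with `LG = G_{a,u,θ}`). -/
def SameWindowPairCovConst : Prop :=
    ∀ (a θ : ℝ) (u : V3), 0 < a → 0 < θ → ∃ σ₀ : ℝ, 0 < σ₀ ∧ ∀ σ : ℝ, 0 < σ → σ < σ₀ →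
      ∀ Φ : (N : ℕ) → Flow σ N, ∀ τ : ℝ, 0 < τ →
      ∀ g : V3 × V3 × V3 → ℝ, Continuous g → (∃ C : ℝ, ∀ p, |g p| ≤ C) →
      ∀ δ : ℝ, 0 < δ → ∃ N₀ : ℕ, ∀ N : ℕ, N₀ ≤ N →
      ∫⁻ z, ENNReal.ofReal (((N : ℝ) + 1) ^ (1 / 3 : ℝ) * (hsDiameter σ N / ((N : ℝ) + 1)) ^ 2 *
          ∑ i : Fin (N + 1), ∑ n ∈ Finset.range (cnt (Φ N) τ z i),
            ∑ i' : Fin (N + 1), ∑ n' ∈ Finset.range (cnt (Φ N) τ z i'),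
              (if PairFar (rs N) (tN N) (past (Φ N) (rs N) z i n) (past (Φ N) (rs N) z i' n') i i'
                then (1 : ℝ) else 0) *
                |pairCondCovLG σ (fun _ => a) (fun _ => θ) (fun _ => u) (Φ N) (rs N) g i n i' n' z|)
          ∂(localGibbsLaw σ (fun _ => a) (fun _ => u) (fun _ => θ) N (Φ N)) ≤ ENNReal.ofReal δ

/-- **(I) Bounded normalised same-window pair count under the invariant law** (second factorial moment of the window
kick counts; `O(1)`, not small): `∃ B ∀ᶠ N, E_G[(N+1)^{1/3}(ε/(N+1))² #{valid ordered pairs in the same kinetic window}] ≤ B`. -/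
def SameWindowPairCountConst : Prop :=
    ∀ (a θ : ℝ) (u : V3), 0 < a → 0 < θ → ∃ σ₀ : ℝ, 0 < σ₀ ∧ ∀ σ : ℝ, 0 < σ → σ < σ₀ →
      ∀ Φ : (N : ℕ) → Flow σ N, ∀ τ : ℝ, 0 < τ → ∃ B : ℝ, ∃ N₀ : ℕ, ∀ N : ℕ, N₀ ≤ N →
      ∫⁻ z, ENNReal.ofReal (((N : ℝ) + 1) ^ (1 / 3 : ℝ) * (hsDiameter σ N / ((N : ℝ) + 1)) ^ 2 *
          ∑ i : Fin (N + 1), ∑ n ∈ Finset.range (cnt (Φ N) τ z i),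
            ∑ i' : Fin (N + 1), ∑ n' ∈ Finset.range (cnt (Φ N) τ z i'),
              (if SameWindow (tN N) (past (Φ N) (rs N) z i n) (past (Φ N) (rs N) z i' n') then (1 : ℝ) else 0))
          ∂(localGibbsLaw σ (fun _ => a) (fun _ => u) (fun _ => θ) N (Φ N)) ≤ ENNReal.ofReal B

/-- **(I′) = `(PM|const)`** — verbatim the hypothesis of `CollisionRate.stub_windowCountSquareTightConst_of_sqMoment`:
the one-window SECOND moment of the tagged-sphere collision count is `O(1)` per sphere under the invariant law.  Implies (I)
(Cauchy–Schwarz over spheres, window alignment); documented open in its home file. -/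
def WindowCountSqMomentConst : Prop :=
    ∀ (ab θb : ℝ) (ub : V3), 0 < ab → 0 < θb → ∃ σ₀ : ℝ, 0 < σ₀ ∧ ∀ σ : ℝ, 0 < σ → σ < σ₀ →
      ∀ Φ : (N : ℕ) → HardSphereFlow (Torus.geometry (Fin 3)) (hsDiameter σ N) (N + 1),
      ∀ τ : ℝ, 0 < τ → ∀ a : ℝ, 0 < a → ∃ C : ℝ, ∃ N₀ : ℕ, ∀ N : ℕ, N₀ ≤ N →
        ∑ i : Fin (N + 1), ∫⁻ z, ENNReal.ofReal (windowCollisions σ N (Φ N) τ a i 0 z ^ 2)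
          ∂(localGibbsLaw σ (fun _ => ab) (fun _ => ub) (fun _ => θb) N (Φ N)) ≤
          ENNReal.ofReal (C * (N + 1 : ℝ))

/-- **(II) = `C⁺_log` of crux `GibbsLightCone` (stmt-AtomisticToContinuum-12501)** — verbatim the hypothesis of
`gibbsLightCone_of_taggedLogWindowSpanTail`: exponential-in-`M` tail of the spatial span of the backward cluster of one
tagged sphere over `1 ≤ M ≤ K log(N+2)` mean free times, every `K`, eventually in `N` (zero drift). -/
def TaggedLogWindowSpanTailConst : Prop :=
    ∀ a θ : ℝ, 0 < a → 0 < θ → ∃ σ₀ : ℝ, 0 < σ₀ ∧ ∃ lam c C : ℝ, 0 < c ∧ ∀ K : ℝ, 0 < K →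
      ∀ σ : ℝ, 0 < σ → σ < σ₀ →
      ∀ Φ : (N : ℕ) → HardSphereFlow (Torus.geometry (Fin 3)) (hsDiameter σ N) (N + 1),
      ∀ᶠ N in atTop, ∀ p : Fin (N + 1), ∀ M : ℝ, 1 ≤ M → M ≤ K * Real.log ((N : ℝ) + 2) →
        localGibbsLaw σ (fun _ => a) (fun _ => 0) (fun _ => θ) N (Φ N)
          {z | ∃ r : Fin (N + 1),
              (r = p ∨ r ∈ (Φ N).backwardCluster p 0
                (M * (((N + 1 : ℕ) : ℝ) ^ (-(1 / 3 : ℝ)) / σ ^ 2 / Real.sqrt θ)) z) ∧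
              lam * M * (((N + 1 : ℕ) : ℝ) ^ (-(1 / 3 : ℝ)) / σ ^ 2) <
                Torus.euclidDist (z r).1
                  (((Φ N).flow (M * (((N + 1 : ℕ) : ℝ) ^ (-(1 / 3 : ℝ)) / σ ^ 2 / Real.sqrt θ)) z)
                    p).1}
          ≤ ENNReal.ofReal (C * Real.exp (-c * M))

/-- **(III) Far-pair conditional decorrelation in pair-Campbell measure**: for every `η > 0`, eventually in `N`, the
`N^{1/3}`-normalised far-pair sum of the EXCESS `(|Γ| − η)₊` has mean `≤ η` under the invariant law (the light-cone +
regional-decoupling content of SW at constant profiles, stripped of the pair count). -/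
def FarPairDecorrelationConst : Prop :=
    ∀ (a θ : ℝ) (u : V3), 0 < a → 0 < θ → ∃ σ₀ : ℝ, 0 < σ₀ ∧ ∀ σ : ℝ, 0 < σ → σ < σ₀ →
      ∀ Φ : (N : ℕ) → Flow σ N, ∀ τ : ℝ, 0 < τ →
      ∀ g : V3 × V3 × V3 → ℝ, Continuous g → (∃ C : ℝ, ∀ p, |g p| ≤ C) →
      ∀ η : ℝ, 0 < η → ∃ N₀ : ℕ, ∀ N : ℕ, N₀ ≤ N →
      ∫⁻ z, ENNReal.ofReal (((N : ℝ) + 1) ^ (1 / 3 : ℝ) * (hsDiameter σ N / ((N : ℝ) + 1)) ^ 2 *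
          ∑ i : Fin (N + 1), ∑ n ∈ Finset.range (cnt (Φ N) τ z i),
            ∑ i' : Fin (N + 1), ∑ n' ∈ Finset.range (cnt (Φ N) τ z i'),
              (if PairFar (rs N) (tN N) (past (Φ N) (rs N) z i n) (past (Φ N) (rs N) z i' n') i i'
                then (1 : ℝ) else 0) *
                max (|pairCondCovLG σ (fun _ => a) (fun _ => θ) (fun _ => u) (Φ N) (rs N) g i n i' n' z| - η) 0)
          ∂(localGibbsLaw σ (fun _ => a) (fun _ => u) (fun _ => θ) N (Φ N)) ≤ ENNReal.ofReal η

/-! ## The elementary split SW_const ⟸ (I) ∧ (III) -/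

/-- One pair: `1_far |x| ≤ η 1_sw + 1_far (|x| − η)₊` whenever `far → sw` and `η ≥ 0`. [folklore] -/
theorem far_term_le {p q : Prop} [Decidable p] [Decidable q] (hpq : p → q) (x : ℝ) {η : ℝ} (hη : 0 ≤ η) :
    (if p then (1 : ℝ) else 0) * |x| ≤
      η * (if q then (1 : ℝ) else 0) + (if p then (1 : ℝ) else 0) * max (|x| - η) 0 := by
  by_cases hp : p
  · have hq : q := hpq hp
    simp only [hp, hq, if_true, one_mul, mul_one]
    linarith [le_max_left (|x| - η) 0]
  · simp only [hp, if_false, zero_mul, add_zero]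
    split_ifs
    · simpa using hη
    · simp

/-- The split summed over the four random ranges. [folklore] -/
theorem sum4_split_le {N : ℕ} (K : Fin (N + 1) → ℕ) (F C D : Fin (N + 1) → ℕ → Fin (N + 1) → ℕ → ℝ) (η : ℝ)
    (h : ∀ i n i' n', F i n i' n' ≤ η * C i n i' n' + D i n i' n') :
    ∑ i, ∑ n ∈ Finset.range (K i), ∑ i', ∑ n' ∈ Finset.range (K i'), F i n i' n' ≤
      η * ∑ i, ∑ n ∈ Finset.range (K i), ∑ i', ∑ n' ∈ Finset.range (K i'), C i n i' n' +
        ∑ i, ∑ n ∈ Finset.range (K i), ∑ i', ∑ n' ∈ Finset.range (K i'), D i n i' n' := by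
  simp only [Finset.mul_sum, ← Finset.sum_add_distrib]
  gcongr with i _ n _ i' _ n' _
  exact h i n i' n'

/-- **SW at constant profiles from the bounded same-window pair count (I) and the far-pair decorrelation (III).**
Given `δ`, take `B` from (I), `η := δ/(max B 0 + 2)`, (III) at `η`; pointwise `far_term_le`, then
`∫⁻ ofReal(η·count + dec) ≤ ofReal η · ∫⁻ ofReal count + ∫⁻ ofReal dec ≤ η B + η ≤ δ` (the count integrand is
a.e.-measurable: off the `G`-null bad set `cnt = gcnt`). [folklore] -/
theorem sameWindowPairCovConst_of_count_of_decorrelation :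
    SameWindowPairCountConst → FarPairDecorrelationConst → SameWindowPairCovConst := by
  intro hI hIII a θ u ha hθ
  obtain ⟨σ₁, hσ₁, h1⟩ := hI a θ u ha hθ
  obtain ⟨σ₂, hσ₂, h2⟩ := hIII a θ u ha hθ
  refine ⟨min σ₁ σ₂, lt_min hσ₁ hσ₂, ?_⟩
  intro σ hσ hσlt Φ τ hτ g hg hgb δ hδ
  obtain ⟨B, N₁, hB⟩ := h1 σ hσ (hσlt.trans_le (min_le_left _ _)) Φ τ hτ
  have hB2 : 0 < max B 0 + 2 := by positivity
  set η : ℝ := δ / (max B 0 + 2) with hηdef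
  have hη : 0 < η := div_pos hδ hB2
  obtain ⟨N₂, hN₂⟩ := h2 σ hσ (hσlt.trans_le (min_le_right _ _)) Φ τ hτ g hg hgb η hη
  refine ⟨max N₁ N₂, fun N hN => ?_⟩
  have hBN := hB N ((le_max_left _ _).trans hN)
  have hDN := hN₂ N ((le_max_right _ _).trans hN)
  set G := localGibbsLaw σ (fun _ => a) (fun _ => u) (fun _ => θ) N (Φ N) with hG
  set P : ℝ := ((N : ℝ) + 1) ^ (1 / 3 : ℝ) * (hsDiameter σ N / ((N : ℝ) + 1)) ^ 2 with hP
  have hP0 : 0 ≤ P := by rw [hP]; positivity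
  -- the three summands, as functions of the indices and the datum
  set sw : Fin (N + 1) → ℕ → Fin (N + 1) → ℕ → Phase N → ℝ := fun i n i' n' z =>
    if SameWindow (tN N) (past (Φ N) (rs N) z i n) (past (Φ N) (rs N) z i' n') then (1 : ℝ) else 0 with hsw
  set far : Fin (N + 1) → ℕ → Fin (N + 1) → ℕ → Phase N → ℝ := fun i n i' n' z =>
    if PairFar (rs N) (tN N) (past (Φ N) (rs N) z i n) (past (Φ N) (rs N) z i' n') i i' then (1 : ℝ) else 0
    with hfar
  set Γ : Fin (N + 1) → ℕ → Fin (N + 1) → ℕ → Phase N → ℝ := fun i n i' n' z =>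
    pairCondCovLG σ (fun _ => a) (fun _ => θ) (fun _ => u) (Φ N) (rs N) g i n i' n' z with hΓ
  -- pointwise split
  have hpt : ∀ z : Phase N,
      P * ∑ i : Fin (N + 1), ∑ n ∈ Finset.range (cnt (Φ N) τ z i),
          ∑ i' : Fin (N + 1), ∑ n' ∈ Finset.range (cnt (Φ N) τ z i'), far i n i' n' z * |Γ i n i' n' z| ≤
        η * (P * ∑ i : Fin (N + 1), ∑ n ∈ Finset.range (cnt (Φ N) τ z i),
          ∑ i' : Fin (N + 1), ∑ n' ∈ Finset.range (cnt (Φ N) τ z i'), sw i n i' n' z) +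
        P * ∑ i : Fin (N + 1), ∑ n ∈ Finset.range (cnt (Φ N) τ z i),
          ∑ i' : Fin (N + 1), ∑ n' ∈ Finset.range (cnt (Φ N) τ z i'),
            far i n i' n' z * max (|Γ i n i' n' z| - η) 0 := by
    intro z
    have hs := sum4_split_le (fun i => cnt (Φ N) τ z i) (fun i n i' n' => far i n i' n' z * |Γ i n i' n' z|)
      (fun i n i' n' => sw i n i' n' z) (fun i n i' n' => far i n i' n' z * max (|Γ i n i' n' z| - η) 0) η
      (fun i n i' n' => by
        simp only [hfar, hsw]
        exact far_term_le (fun h => h.1) _ hη.le)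
    have := mul_le_mul_of_nonneg_left hs hP0
    linarith [this]
  -- a.e.-measurability of the count integrand (genuine counts = guarded counts on the good set)
  have hsw_meas : ∀ i n i' n', Measurable fun z => sw i n i' n' z := by
    intro i n i' n'
    have hpair : Measurable fun z : Phase N => (past (Φ N) (rs N) z i n, past (Φ N) (rs N) z i' n') :=
      (measurable_past (Φ N) (rs N) i n).prodMk (measurable_past (Φ N) (rs N) i' n')
    have hS : MeasurableSet {z : Phase N | SameWindow (tN N) (past (Φ N) (rs N) z i n) (past (Φ N) (rs N) z i' n')} :=
      hpair (measurableSet_sameWindow N (tN N))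
    simp only [hsw]
    exact Measurable.ite hS measurable_const measurable_const
  have hCntG : Measurable fun z : Phase N => ENNReal.ofReal (η * (P *
      ∑ i : Fin (N + 1), ∑ n ∈ Finset.range (gcnt (Φ N) τ z i),
        ∑ i' : Fin (N + 1), ∑ n' ∈ Finset.range (gcnt (Φ N) τ z i'), sw i n i' n' z)) := by
    refine ENNReal.measurable_ofReal.comp (Measurable.const_mul (Measurable.const_mul ?_ P) η)
    refine Finset.measurable_sum _ fun i _ => ?_
    refine measurable_sum_range_of_measurable (F := fun n z => ∑ i' : Fin (N + 1),
      ∑ n' ∈ Finset.range (gcnt (Φ N) τ z i'), sw i n i' n' z) (fun n => ?_)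
      (measurable_gcnt stub_pastMeasurable hσ (Φ N) τ i)
    refine Finset.measurable_sum _ fun i' _ => ?_
    exact measurable_sum_range_of_measurable (F := fun n' z => sw i n i' n' z) (fun n' => hsw_meas i n i' n')
      (measurable_gcnt stub_pastMeasurable hσ (Φ N) τ i')
  have hgood : ∀ᵐ z ∂G, z ∈ (Φ N).good := mem_ae_iff.2 (localGibbsLaw_compl_good_eq_zero (Φ N))
  have hCnt_ae : AEMeasurable (fun z : Phase N => ENNReal.ofReal (η * (P *
      ∑ i : Fin (N + 1), ∑ n ∈ Finset.range (cnt (Φ N) τ z i),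
        ∑ i' : Fin (N + 1), ∑ n' ∈ Finset.range (cnt (Φ N) τ z i'), sw i n i' n' z))) G := by
    refine hCntG.aemeasurable.congr (hgood.mono fun z hz => ?_)
    simp only [gcnt, hz, if_true]
  -- assemble
  calc ∫⁻ z, ENNReal.ofReal (P * ∑ i : Fin (N + 1), ∑ n ∈ Finset.range (cnt (Φ N) τ z i),
          ∑ i' : Fin (N + 1), ∑ n' ∈ Finset.range (cnt (Φ N) τ z i'), far i n i' n' z * |Γ i n i' n' z|) ∂G
      ≤ ∫⁻ z, (ENNReal.ofReal (η * (P * ∑ i : Fin (N + 1), ∑ n ∈ Finset.range (cnt (Φ N) τ z i),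
            ∑ i' : Fin (N + 1), ∑ n' ∈ Finset.range (cnt (Φ N) τ z i'), sw i n i' n' z)) +
          ENNReal.ofReal (P * ∑ i : Fin (N + 1), ∑ n ∈ Finset.range (cnt (Φ N) τ z i),
            ∑ i' : Fin (N + 1), ∑ n' ∈ Finset.range (cnt (Φ N) τ z i'),
              far i n i' n' z * max (|Γ i n i' n' z| - η) 0)) ∂G :=
        lintegral_mono fun z => (ENNReal.ofReal_le_ofReal (hpt z)).trans ENNReal.ofReal_add_le
    _ = ∫⁻ z, ENNReal.ofReal (η * (P * ∑ i : Fin (N + 1), ∑ n ∈ Finset.range (cnt (Φ N) τ z i),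
            ∑ i' : Fin (N + 1), ∑ n' ∈ Finset.range (cnt (Φ N) τ z i'), sw i n i' n' z)) ∂G +
          ∫⁻ z, ENNReal.ofReal (P * ∑ i : Fin (N + 1), ∑ n ∈ Finset.range (cnt (Φ N) τ z i),
            ∑ i' : Fin (N + 1), ∑ n' ∈ Finset.range (cnt (Φ N) τ z i'),
              far i n i' n' z * max (|Γ i n i' n' z| - η) 0) ∂G := lintegral_add_left' hCnt_ae _
    _ = ENNReal.ofReal η * ∫⁻ z, ENNReal.ofReal (P * ∑ i : Fin (N + 1), ∑ n ∈ Finset.range (cnt (Φ N) τ z i),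
            ∑ i' : Fin (N + 1), ∑ n' ∈ Finset.range (cnt (Φ N) τ z i'), sw i n i' n' z) ∂G +
          ∫⁻ z, ENNReal.ofReal (P * ∑ i : Fin (N + 1), ∑ n ∈ Finset.range (cnt (Φ N) τ z i),
            ∑ i' : Fin (N + 1), ∑ n' ∈ Finset.range (cnt (Φ N) τ z i'),
              far i n i' n' z * max (|Γ i n i' n' z| - η) 0) ∂G := by
        rw [← lintegral_const_mul' _ _ ENNReal.ofReal_ne_top]
        simp_rw [ENNReal.ofReal_mul hη.le]
    _ ≤ ENNReal.ofReal η * ENNReal.ofReal B + ENNReal.ofReal η := add_le_add (mul_le_mul' le_rfl hBN) hDN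
    _ ≤ ENNReal.ofReal δ := by
        have hBle : ENNReal.ofReal B ≤ ENNReal.ofReal (max B 0) := ENNReal.ofReal_le_ofReal (le_max_left _ _)
        calc ENNReal.ofReal η * ENNReal.ofReal B + ENNReal.ofReal η
            ≤ ENNReal.ofReal η * ENNReal.ofReal (max B 0) + ENNReal.ofReal η := by gcongr
          _ = ENNReal.ofReal (η * max B 0 + η) := by
              rw [ENNReal.ofReal_add (by positivity) hη.le, ENNReal.ofReal_mul hη.le]
          _ ≤ ENNReal.ofReal δ := by
              refine ENNReal.ofReal_le_ofReal ?_
              have h1 : η * max B 0 + η ≤ η * (max B 0 + 2) := by nlinarith [hη.le]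
              have h2 : η * (max B 0 + 2) = δ := by rw [hηdef]; field_simp
              linarith

end Summit.AtomisticToContinuum.HydrodynamicLimit.Theorems.KickFairRelEquilibriumMesoLine

end
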